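import Summits.HubbardSuperconductivity.HubbardSuperconductivity.Theorems.AnisotropyChordTransferLinear

/-!
# Route `AnisotropyChord` / H0 rotor rung, route (1): LEMMA X PROVED — the tower excess is LINEAR in the sector index
# (theory seat `hubbard-h0-rotor-theory-1`, cycle 14, Part N14 v2 Part F; verbatim port, file 2 of 3 of PORT SPEC W)

`towerExcess_linear : -1 ≤ Δ → Δ ≤ 1 → TowerExcessLinear Δ 32`: for the Perron amplitude `a` of sector `M`, `4M ≤ L²`,
`⟨S⁺a, H S⁺a⟩ − E(M+1)‖S⁺a‖² ≤ 4(1−Δ)L² + 32·M`.  Inputs (all tree theorems): LEMMA E `ladderExcessBound_holds`, the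
variational floor in sector `M − 1`, E-CONV `xxzSectorEnergyConvex_holds` (sector energies convex in the magnetisation), the
convex secant to the top sector and the energy window `perron_energy_bond_sum` / `brkMass ≤ 1` / `hopCorr ≤ 1` /
`adjCount ≤ 4L²`.  Statement and consequences: `AnisotropyChordTransferLinear`; discharged consequences:
`AnisotropyChordTransferLinearHolds`.  (Port of `cycle14/lean/PartN14.lean` v2, sha16 c04a6387500447e8, by the prover seat
`hubbard-h0-rotor-p1` g18; no new mathematics.)
-/


set_option linter.dupNamespace false
set_option autoImplicit false

noncomputable section

open Finset Filter Topology
open Literature.MathematicalPhysics.QuantumLattice Literature.Probability.LatticeModels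
open Summit.HubbardSuperconductivity.HubbardSuperconductivity.Theorems.AnisotropyChord
open Summit.HubbardSuperconductivity.HubbardSuperconductivity.Theorems.AnisotropyChord.InsertionEntropy
open Summit.HubbardSuperconductivity.HubbardSuperconductivity.Theorems.AnisotropyChord.Transfer
open Summit.HubbardSuperconductivity.HubbardSuperconductivity.Theorems.AnisotropyChord.Tower

namespace Summit.HubbardSuperconductivity.HubbardSuperconductivity.Theorems.AnisotropyChord.Transfer

/-! ## Part F — LEMMA X PROVED (port spec W1): E-CONV + LEMMA E + energy window -/

section LemmaX
variable {L : ℕ} [NeZero L]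

/-- A Perron sector amplitude witnesses that its sector is non-trivial. [folklore] -/
theorem spinZSector_ne_bot_of_perron {Δ M : ℝ} {a : TensorIndex (TorusSite 2 L) 2 → ℝ}
    (ha : IsPerronSectorGroundAmplitude L Δ M a) : spinZSector (Λ := TorusSite 2 L) 1 M ≠ ⊥ := by
  intro h
  have hmem := ha.sector
  rw [h, Submodule.mem_bot] at hmem
  have hzero : ∀ σ, a σ = 0 := fun σ => by
    have := congr_fun hmem σ
    simpa using this
  have hu := ha.unit
  simp [hzero] at hu

/-- E-CONV on the torus, in `sectorE` currency: `2E(M) ≤ E(M−1) + E(M+1)` whenever the three sectors carry Perron amplitudes.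
(`xxzSectorEnergyConvex_holds`.) [folklore] -/
theorem sectorE_convex {Δ : ℝ} (hΔm : -1 ≤ Δ) (hΔ1 : Δ ≤ 1) {M : ℝ}
    {bm b bp : TensorIndex (TorusSite 2 L) 2 → ℝ}
    (hbm : IsPerronSectorGroundAmplitude L Δ (M - 1) bm) (hb : IsPerronSectorGroundAmplitude L Δ M b)
    (hbp : IsPerronSectorGroundAmplitude L Δ (M + 1) bp) :
    2 * sectorE L Δ M ≤ sectorE L Δ (M - 1) + sectorE L Δ (M + 1) := by
  have h := xxzSectorEnergyConvex_holds (TorusSite 2 L) (torusGraph 2 L) Δ hΔm hΔ1 M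
    (spinZSector_ne_bot_of_perron hbm) (spinZSector_ne_bot_of_perron hb) (spinZSector_ne_bot_of_perron hbp)
  simpa only [sectorE_eq] using h

/-- Energy window of a Perron sector: `−D(4−Δ)/8 ≤ E(M) ≤ D(2−Δ)/8`, `D = adjCount` (from `perron_energy_bond_sum`,
`0 ≤ brkMass ≤ 1`, `0 ≤ hopCorr ≤ 1`). [folklore] -/
theorem sectorE_window {Δ M : ℝ} (hΔ1 : Δ ≤ 1) {a : TensorIndex (TorusSite 2 L) 2 → ℝ}
    (ha : IsPerronSectorGroundAmplitude L Δ M a) :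
    -(adjCount (torusGraph 2 L) * ((4 - Δ) / 8)) ≤ sectorE L Δ M
      ∧ sectorE L Δ M ≤ adjCount (torusGraph 2 L) * ((2 - Δ) / 8) := by
  have h := perron_energy_bond_sum ha
  have hD : (∑ x : TorusSite 2 L, ∑ y, if (torusGraph 2 L).Adj x y then (1:ℝ) else 0) = adjCount (torusGraph 2 L) := rfl
  rw [hD] at h
  obtain ⟨S₁, hS₁⟩ : ∃ S : ℝ, S = ∑ x : TorusSite 2 L, ∑ y,
      if (torusGraph 2 L).Adj x y then (brkMass a x y - hopCorr a x y) else 0 := ⟨_, rfl⟩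
  obtain ⟨S₂, hS₂⟩ : ∃ S : ℝ, S = ∑ x : TorusSite 2 L, ∑ y,
      if (torusGraph 2 L).Adj x y then brkMass a x y else 0 := ⟨_, rfl⟩
  rw [← hS₁, ← hS₂] at h
  have key : ∀ x y : TorusSite 2 L, 0 ≤ brkMass a x y ∧ brkMass a x y ≤ 1 ∧ 0 ≤ hopCorr a x y ∧ hopCorr a x y ≤ 1 :=
    fun x y => ⟨brkMass_nonneg a x y, by have := brkMass_le_sum_sq a x y; rw [ha.unit] at this; exact this,
      hopCorr_nonneg ha.nonneg x y, hopCorr_le_one ha x y⟩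
  have hS₂0 : 0 ≤ S₂ := by
    rw [hS₂]
    refine Finset.sum_nonneg fun x _ => Finset.sum_nonneg fun y _ => ?_
    split_ifs
    · exact (key x y).1
    · exact le_rfl
  have hS₂D : S₂ ≤ adjCount (torusGraph 2 L) := by
    rw [hS₂]; unfold adjCount
    refine Finset.sum_le_sum fun x _ => Finset.sum_le_sum fun y _ => ?_
    split_ifs
    · exact (key x y).2.1
    · exact le_rfl
  have hS₁D : S₁ ≤ adjCount (torusGraph 2 L) := by
    rw [hS₁]; unfold adjCount
    refine Finset.sum_le_sum fun x _ => Finset.sum_le_sum fun y _ => ?_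
    split_ifs
    · linarith [(key x y).2.1, (key x y).2.2.1]
    · exact le_rfl
  have hS₁D' : -adjCount (torusGraph 2 L) ≤ S₁ := by
    rw [hS₁]; unfold adjCount
    rw [← Finset.sum_neg_distrib]
    refine Finset.sum_le_sum fun x _ => ?_
    rw [← Finset.sum_neg_distrib]
    refine Finset.sum_le_sum fun y _ => ?_
    split_ifs
    · linarith [(key x y).1, (key x y).2.2.2]
    · simp
  have hη0 : 0 ≤ 1 - Δ := by linarith
  have h1 : 0 ≤ (1 - Δ) * S₂ := mul_nonneg hη0 hS₂0
  have h2 : (1 - Δ) * S₂ ≤ (1 - Δ) * adjCount (torusGraph 2 L) := mul_le_mul_of_nonneg_left hS₂D hη0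
  constructor
  · nlinarith
  · nlinarith

/-- Secant inequality for a convex sequence: monotone increments sum. [folklore] -/
theorem secant_of_convex (e : ℕ → ℝ) (p n : ℕ)
    (h : ∀ t : ℕ, p < t → t ≤ p + n → 2 * e t ≤ e (t - 1) + e (t + 1)) :
    ((n : ℝ) + 1) * (e (p + 1) - e p) ≤ e (p + n + 1) - e p := by
  have mono : ∀ k, k ≤ n → e (p + 1) - e p ≤ e (p + k + 1) - e (p + k) := by
    intro k hk
    induction k with
    | zero => simp
    | succ k ih =>
      have h1 := ih (by omega)
      have h2 := h (p + k + 1) (by omega) (by omega)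
      have e1 : p + k + 1 - 1 = p + k := by omega
      rw [e1] at h2
      rw [show p + (k + 1) = p + k + 1 by ring]
      linarith
  have hsum : ∀ m, m ≤ n + 1 → (m : ℝ) * (e (p + 1) - e p) ≤ e (p + m) - e p := by
    intro m hm
    induction m with
    | zero => simp
    | succ m ih =>
      have h1 := ih (by omega)
      have h2 := mono m (by omega)
      push_cast
      rw [show p + (m + 1) = p + m + 1 by ring]
      linarith
  have := hsum (n + 1) le_rfl
  push_cast at this
  rw [show p + (n + 1) = p + n + 1 by ring] at this
  exact this

/-- `‖S⁺b‖² ≥ 0` (sum of squares; primed to avoid the tree's sector-hypothesis version). [folklore] -/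
theorem raiseNormSq_nonneg' (b : TensorIndex (TorusSite 2 L) 2 → ℝ) : 0 ≤ raiseNormSq b := by
  unfold raiseNormSq; exact Finset.sum_nonneg fun _ _ => sq_nonneg _


/-- **LEMMA X (port spec W1) — PROVED from tree theorems.**  For every `−1 ≤ Δ ≤ 1` the tower excess numerator of a Perron
sector amplitude `ψ_M` (`M ≥ 0`, `4M ≤ L²`) obeys `⟨S⁺ψ_M, H S⁺ψ_M⟩ − E(M+1)‖S⁺ψ_M‖² ≤ 4(1−Δ)L² + 32·M`.
Inputs: LEMMA E `ladderExcessBound_holds`, the variational floor `sectorE_pred_mul_le`, `‖S⁻ψ‖² = ‖S⁺ψ‖² + 2M`,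
E-CONV `xxzSectorEnergyConvex_holds` (at `M`, and as monotone increments up to the top sector `n₀ = L²/2`), the energy window
`sectorE_window` and `adjCount_torus_le`. [folklore] -/
theorem towerExcess_linear {Δ : ℝ} (hΔm : -1 ≤ Δ) (hΔ1 : Δ ≤ 1) :
    TowerExcessLinear Δ 32 := by
  intro L _ M h4M a ha
  -- parity, the sector-0 amplitude, the half-filling index `n₀ = L²/2`
  have hev : Even L := even_of_perron_nat ha
  obtain ⟨a₀, ha₀⟩ := exists_perron_zero_of_even Δ hev
  obtain ⟨n₀, hn₀, -⟩ := exists_half_of_perron_zero ha₀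
  have hL2 : 2 ≤ L := by
    obtain ⟨m, hm⟩ := hev
    have := NeZero.ne L
    omega
  have hL4 : 4 ≤ L ^ 2 := by
    calc 4 = 2 ^ 2 := by norm_num
      _ ≤ L ^ 2 := Nat.pow_le_pow_left hL2 2
  have hn₀2 : 2 ≤ n₀ := by omega
  have h2M : 2 * M ≤ n₀ := by omega
  -- Perron amplitudes `ψ_i`, `0 ≤ i ≤ n₀`
  have hexN : ∀ i : ℕ, i ≤ n₀ → ∃ b : TensorIndex (TorusSite 2 L) 2 → ℝ,
      IsPerronSectorGroundAmplitude L Δ (i : ℝ) b := fun i hi => exists_perron_nat ha₀ i (by omega)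
  choose! ψ hψ using hexN
  have hW : (L : ℝ) ^ 2 = 2 * (n₀ : ℝ) := by exact_mod_cast hn₀.symm
  have hM0 : (0 : ℝ) ≤ M := Nat.cast_nonneg _
  -- LEMMA E at `M` and the variational floor at `M − 1`
  have hE := ladderExcessBound_holds L Δ (M : ℝ) hΔ1 a ha
  have hfl := sectorE_pred_mul_le ha
  have hNN : lowerNormSq a = raiseNormSq a + 2 * (M : ℝ) := by
    rw [raiseNormSq_eq_totalSpinSq ha, lowerNormSq_eq_totalSpinSq (M : ℝ) a]; ring
  have hN0 : 0 ≤ raiseNormSq a := raiseNormSq_nonneg' a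
  -- E-CONV at `M`
  obtain ⟨bp, hbp⟩ : ∃ b : TensorIndex (TorusSite 2 L) 2 → ℝ,
      IsPerronSectorGroundAmplitude L Δ ((M : ℝ) + 1) b := by
    refine ⟨ψ (M + 1), ?_⟩
    have := hψ (M + 1) (by omega)
    push_cast at this
    exact this
  obtain ⟨bm, hbm⟩ : ∃ b : TensorIndex (TorusSite 2 L) 2 → ℝ,
      IsPerronSectorGroundAmplitude L Δ ((M : ℝ) - 1) b := by
    rcases Nat.eq_zero_or_pos M with hM | hM
    · obtain ⟨b, hb⟩ := exists_perron_neg_one ha₀ (by omega)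
      refine ⟨b, ?_⟩
      subst hM
      simpa using hb
    · have hM1 : 1 ≤ M := hM
      refine ⟨ψ (M - 1), ?_⟩
      have := hψ (M - 1) (by omega)
      rw [Nat.cast_sub hM1] at this
      simpa using this
  have hconv := sectorE_convex hΔm hΔ1 hbm ha hbp
  -- `2M·μ₋ ≤ 32M`, `μ₋ = E(M) − E(M−1)`: monotone increments up to `n₀`, energy window, `D ≤ 4L²`
  have hμ : 2 * (M : ℝ) * (sectorE L Δ (M : ℝ) - sectorE L Δ ((M : ℝ) - 1)) ≤ 32 * (M : ℝ) := by
    rcases Nat.eq_zero_or_pos M with hM | hM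
    · subst hM; simp
    · have hM1 : 1 ≤ M := hM
      have hMn : M ≤ n₀ := by omega
      have hsec := secant_of_convex (fun i : ℕ => sectorE L Δ (i : ℝ)) (M - 1) (n₀ - M)
        (fun t ht1 ht2 => by
          have hb1 := hψ (t - 1) (by omega)
          have hb2 := hψ t (by omega)
          have hb3 := hψ (t + 1) (by omega)
          have ht1' : 1 ≤ t := by omega
          rw [Nat.cast_sub ht1'] at hb1
          push_cast at hb1 hb3
          have := sectorE_convex hΔm hΔ1 hb1 hb2 hb3
          show 2 * sectorE L Δ ((t : ℕ) : ℝ) ≤ sectorE L Δ ((t - 1 : ℕ) : ℝ) + sectorE L Δ ((t + 1 : ℕ) : ℝ)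
          rw [Nat.cast_sub ht1']
          push_cast
          exact this)
      have e1 : M - 1 + 1 = M := by omega
      have e2 : M - 1 + (n₀ - M) + 1 = n₀ := by omega
      simp only [e1, e2] at hsec
      rw [Nat.cast_sub hM1, Nat.cast_sub hMn] at hsec
      push_cast at hsec
      have hwT := (sectorE_window hΔ1 (hψ n₀ le_rfl)).2
      have hwB := (sectorE_window hΔ1 hbm).1
      have hD := adjCount_torus_le (L := L)
      have hD0 : 0 ≤ adjCount (torusGraph 2 L) := by
        unfold adjCount
        exact Finset.sum_nonneg fun x _ => Finset.sum_nonneg fun y _ => by split_ifs <;> norm_num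
      have hDΔ : 0 ≤ adjCount (torusGraph 2 L) * (Δ + 1) := mul_nonneg hD0 (by linarith)
      have hdiff : sectorE L Δ (n₀ : ℝ) - sectorE L Δ ((M : ℝ) - 1) ≤ 4 * (L : ℝ) ^ 2 := by nlinarith
      have hlen : (L : ℝ) ^ 2 / 4 ≤ (n₀ : ℝ) - M + 1 := by
        have : (2 * M : ℝ) ≤ n₀ := by exact_mod_cast h2M
        linarith
      by_cases hμ0 : sectorE L Δ (M : ℝ) - sectorE L Δ ((M : ℝ) - 1) ≤ 0
      · have := mul_nonneg hM0 (by linarith : (0 : ℝ) ≤ -(sectorE L Δ (M : ℝ) - sectorE L Δ ((M : ℝ) - 1)))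
        nlinarith
      · push Not at hμ0
        have hLsq : (0 : ℝ) < (L : ℝ) ^ 2 := by positivity
        have h1 : (sectorE L Δ (M : ℝ) - sectorE L Δ ((M : ℝ) - 1)) * ((L : ℝ) ^ 2 / 4)
            ≤ (sectorE L Δ (M : ℝ) - sectorE L Δ ((M : ℝ) - 1)) * ((n₀ : ℝ) - M + 1) :=
          mul_le_mul_of_nonneg_left hlen hμ0.le
        have h2 : (sectorE L Δ (M : ℝ) - sectorE L Δ ((M : ℝ) - 1)) * ((n₀ : ℝ) - M + 1)
            ≤ 4 * (L : ℝ) ^ 2 := by linarith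
        have h3 : sectorE L Δ (M : ℝ) - sectorE L Δ ((M : ℝ) - 1) ≤ 16 := by
          by_contra h4
          push Not at h4
          nlinarith
        have := mul_le_mul_of_nonneg_left h3 hM0
        nlinarith
  -- assemble: `X·N = [ep − μ₊N]`, `ep ≤ 4ηL² − em`, `em ≥ −μ₋Ñ`, `Ñ = N + 2M`, E-CONV at `M`, `2Mμ₋ ≤ 32M`
  rw [hNN] at hE hfl
  have hc : 0 ≤ (sectorE L Δ ((M : ℝ) - 1) + sectorE L Δ ((M : ℝ) + 1) - 2 * sectorE L Δ (M : ℝ)) * raiseNormSq a :=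
    mul_nonneg (by linarith) hN0
  nlinarith [hE, hfl, hμ, hc]

end LemmaX

/-- **`TowerExcessLinearHolds` — PROVED.** [folklore] -/
theorem towerExcessLinearHolds : TowerExcessLinearHolds := fun _ hΔm hΔ1 => towerExcess_linear hΔm hΔ1

end Summit.HubbardSuperconductivity.HubbardSuperconductivity.Theorems.AnisotropyChord.Transfer
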